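import Summits.Ventures.PercRepro.RankLevelSetExplicitMultArithB

/-!
# PercRepro — THE ARITHMETIC OF THEOREM P⁗′, PART A: THE LINEAR-EXPONENT THRESHOLD `Tlin q = 20·q·2^q`, THE
DOUBLING LEMMA AND THE TAIL UNDER LEMMA T_k (p9, S4)

`proofs/SUBCLAIM-S4-p9.md` §S4.2⁗. THEOREM P⁗ (`RankLevelSetExplicitMult`) has the threshold `q·2^{⌈5q/4⌉+2} + 5q·2^{q+2}`;
its exponent `5/4` comes from the `k ≥ 5` circuit counts `s_k ≤ C(d+k−1, k)` (one power of `d` more than Lemma T / T4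
give at `k = 3, 4`). LEMMA T_k (`RankLevelSetCircuitCountSparse`: on the `e`-free core `s_k ≤ 2^{k−1}·C(d+k−2, k−1)`)
removes that power: with the DOUBLING LEMMA `2^j·C(m, j) ≤ C(2m, j)` the tail becomes
`Σ_{k ∈ [5, q+1]} 2^{k−1}·C(d+k−2, k−1)·C(n, q+1−k) ≤ C(2d+2q−2, 4)·C(2d+2q−6+n, q−4)` (`tail_sum_le_sparse`), a
degree-`4` factor in `d` in place of `C(d+q, 5)`, and the `(S5)` term needs only `p ≳ 6.4·q·2^q`. The whole chain then
holds from `Tlin q := 20·q·2^q` (`(S3)` in regime (ii) needs `18q·2^q`): the explicit threshold has the SHAPE of the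
per-level ladders (`≈ 1.4·(q+1)·2^{q−1}` at `q ≤ 10`), `Tlin 7 = 17 920`, `Tlin 8 = 40 960`, `Tlin 10 = 204 800`,
`Tlin 20 ≈ 4.2·10^8`. Axioms: standard.
-/

namespace PercRepro

namespace ThmN

namespace Explicit

/-- **The linear-exponent threshold** `Tlin q = 20·q·2^q`. -/
def Tlin (q : ℕ) : ℕ := 20 * q * 2 ^ q

/-- The regime thresholds below `Tlin q` (`q ≥ 4`): `N₁ q`, `16q·2^q`, `3(2q + 2^q) + 5`, `6(q+2)·2^q`, `q + 3`. -/
theorem Tlin_bounds (q : ℕ) (hq : 4 ≤ q) :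
    2 ^ (q + 1) + 2 * q ^ 2 + 4 * q + 4 ≤ Tlin q ∧ 16 * q * 2 ^ q ≤ Tlin q ∧ 3 * (2 * q + 2 ^ q) + 5 ≤ Tlin q ∧
      6 * (q + 2) * 2 ^ q ≤ Tlin q ∧ q + 3 ≤ Tlin q := by
  unfold Tlin
  have hx := succ_le_two_pow q
  have h1 : 2 ^ (q + 1) = 2 * 2 ^ q := by rw [pow_add]; ring
  rw [h1]
  refine ⟨?_, ?_, ?_, ?_, ?_⟩ <;> nlinarith

/-- `Tlin` grows: `Tlin q + 1 ≤ Tlin (q + 1)`. -/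
theorem Tlin_succ_le (q : ℕ) : Tlin q + 1 ≤ Tlin (q + 1) := by
  unfold Tlin
  have h1 : 2 ^ (q + 1) = 2 * 2 ^ q := by rw [pow_add]; ring
  have h2 : 1 ≤ 2 ^ q := Nat.one_le_two_pow
  rw [h1]
  nlinarith

/-- `p ≥ Tlin q` gives `p² ≥ 400q²x²`, `p³ ≥ 8000q³x³`, `p⁴ ≥ 160000q⁴x⁴` (`x = 2^q`) and `p ≥ 1`. -/
theorem p_lin_bounds (q p : ℕ) (hq : 4 ≤ q) (hp : Tlin q ≤ p) :
    400 * q ^ 2 * (2 ^ q) ^ 2 ≤ p ^ 2 ∧ 8000 * q ^ 3 * (2 ^ q) ^ 3 ≤ p ^ 3 ∧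
      160000 * q ^ 4 * (2 ^ q) ^ 4 ≤ p ^ 4 ∧ 1 ≤ p := by
  have h : 20 * q * 2 ^ q ≤ p := hp
  refine ⟨?_, ?_, ?_, ?_⟩
  · calc 400 * q ^ 2 * (2 ^ q) ^ 2 = (20 * q * 2 ^ q) ^ 2 := by ring
      _ ≤ p ^ 2 := Nat.pow_le_pow_left h 2
  · calc 8000 * q ^ 3 * (2 ^ q) ^ 3 = (20 * q * 2 ^ q) ^ 3 := by ring
      _ ≤ p ^ 3 := Nat.pow_le_pow_left h 3
  · calc 160000 * q ^ 4 * (2 ^ q) ^ 4 = (20 * q * 2 ^ q) ^ 4 := by ring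
      _ ≤ p ^ 4 := Nat.pow_le_pow_left h 4
  · have : 1 ≤ 2 ^ q := Nat.one_le_two_pow
    nlinarith

/-- **The doubling lemma**: `2^j·C(m, j) ≤ C(2m, j)` (termwise `(2m − i)/(m − i) ≥ 2`). -/
theorem two_pow_mul_choose_le_choose_two_mul (m : ℕ) : ∀ j, 2 ^ j * m.choose j ≤ (2 * m).choose j := by
  intro j
  induction j with
  | zero => simp
  | succ j ih =>
    rcases Nat.lt_or_ge m (j + 1) with hlt | hge
    · rw [Nat.choose_eq_zero_of_lt hlt]; simp
    · have h1 := Nat.choose_succ_right_eq (2 * m) j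
      have h2 := Nat.choose_succ_right_eq m j
      have hpos : 0 < j + 1 := Nat.succ_pos j
      apply Nat.le_of_mul_le_mul_right _ hpos
      calc 2 ^ (j + 1) * m.choose (j + 1) * (j + 1) = 2 ^ j * 2 * (m.choose (j + 1) * (j + 1)) := by ring
        _ = 2 ^ j * 2 * (m.choose j * (m - j)) := by rw [h2]
        _ = 2 ^ j * m.choose j * (2 * (m - j)) := by ring
        _ ≤ (2 * m).choose j * (2 * m - j) := Nat.mul_le_mul ih (by omega)
        _ = (2 * m).choose (j + 1) * (j + 1) := h1.symm

/-- `C(a, j) ≤ C(a, 4)·C(a − 4, j − 4)` for `j ≥ 4`. -/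
theorem choose_le_choose_four_mul (a j : ℕ) (hj : 4 ≤ j) :
    a.choose j ≤ a.choose 4 * (a - 4).choose (j - 4) := by
  have hm := Nat.choose_mul (n := a) (k := j) (s := 4) hj
  have hpos : 1 ≤ j.choose 4 := Nat.choose_pos hj
  calc a.choose j ≤ a.choose j * j.choose 4 := Nat.le_mul_of_pos_right _ hpos
    _ = a.choose 4 * (a - 4).choose (j - 4) := hm

/-- **The tail under LEMMA T_k**: for `q ≥ 4`,
`Σ_{k ∈ [5, q+1]} 2^{k−1}·C(d+k−2, k−1)·C(n, q+1−k) ≤ C(2d+2q−2, 4)·C(2d+2q−6+n, q−4)`. -/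
theorem tail_sum_le_sparse (q d n : ℕ) (hq : 4 ≤ q) :
    ∑ k ∈ Finset.Icc 5 (q + 1), 2 ^ (k - 1) * (d + k - 2).choose (k - 1) * n.choose (q + 1 - k) ≤
      (2 * d + 2 * q - 2).choose 4 * (2 * d + 2 * q - 6 + n).choose (q - 4) := by
  have h1 : ∀ k ∈ Finset.Icc 5 (q + 1), 2 ^ (k - 1) * (d + k - 2).choose (k - 1) * n.choose (q + 1 - k) ≤
      (2 * d + 2 * q - 2).choose 4 * ((2 * d + 2 * q - 6).choose (k - 5) * n.choose (q + 1 - k)) := by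
    intro k hk
    rw [Finset.mem_Icc] at hk
    have ha : 2 ^ (k - 1) * (d + k - 2).choose (k - 1) ≤ (2 * (d + k - 2)).choose (k - 1) :=
      two_pow_mul_choose_le_choose_two_mul (d + k - 2) (k - 1)
    have hb : (2 * (d + k - 2)).choose (k - 1) ≤ (2 * d + 2 * q - 2).choose (k - 1) :=
      Nat.choose_le_choose (k - 1) (by omega)
    have hc := choose_le_choose_four_mul (2 * d + 2 * q - 2) (k - 1) (by omega)
    rw [show 2 * d + 2 * q - 2 - 4 = 2 * d + 2 * q - 6 by omega, show k - 1 - 4 = k - 5 by omega] at hc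
    calc 2 ^ (k - 1) * (d + k - 2).choose (k - 1) * n.choose (q + 1 - k)
        ≤ ((2 * d + 2 * q - 2).choose 4 * (2 * d + 2 * q - 6).choose (k - 5)) * n.choose (q + 1 - k) :=
          Nat.mul_le_mul_right _ ((ha.trans hb).trans hc)
      _ = _ := by ring
  refine (Finset.sum_le_sum h1).trans ?_
  rw [← Finset.mul_sum]
  apply le_of_eq
  congr 1
  rw [Nat.add_choose_eq, Finset.Nat.sum_antidiagonal_eq_sum_range_succ_mk]
  rw [show Finset.Icc 5 (q + 1) = Finset.image (fun i => 5 + i) (Finset.range (q - 4).succ) from ?_]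
  · rw [Finset.sum_image (fun a _ b _ h => by omega)]
    apply Finset.sum_congr rfl
    intro i _
    rw [show 5 + i - 5 = i by omega, show q + 1 - (5 + i) = q - 4 - i by omega]
  · ext k
    simp only [Finset.mem_Icc, Finset.mem_image, Finset.mem_range]
    constructor
    · intro hk
      exact ⟨k - 5, by omega, by omega⟩
    · rintro ⟨i, hi, rfl⟩
      omega

/-- `24·C(a, 4) ≤ a^4`. -/
theorem choose_four_mul_le (a : ℕ) : 24 * a.choose 4 ≤ a ^ 4 := by
  have h1 := Nat.descFactorial_eq_factorial_mul_choose a 4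
  have h2 := Nat.descFactorial_le_pow a 4
  rw [h1] at h2
  simpa [Nat.factorial] using h2

/-- **(S5′) the tail term under LEMMA T_k**:
`192·2^q·C(2d+2q−2, 4)·C(2d+2q−6+(p+d), q−4) ≤ 10·μ·C(p+q, q)` for `p ≥ Tlin q`, `μ = min (2^{q−1} − q) d`. -/
theorem small_five_bound_lin (q d p μ : ℕ) (hq : 4 ≤ q) (hd1 : q + 1 ≤ d) (hd2 : d ≤ q + 2 ^ q)
    (hp : Tlin q ≤ p) (hμ : μ = min (2 ^ (q - 1) - q) d) :
    192 * 2 ^ q * ((2 * d + 2 * q - 2).choose 4 * (2 * d + 2 * q - 6 + (p + d)).choose (q - 4)) ≤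
      10 * μ * (p + q).choose q := by
  obtain ⟨hy, hz, hqy, hqz⟩ := two_pow_facts q hq
  obtain ⟨-, -, hp4, hp1⟩ := p_lin_bounds q p hq hp
  obtain ⟨-, h16, -, -, -⟩ := Tlin_bounds q hq
  have hx := succ_le_two_pow q
  have h2 : (2 * d + 2 * q - 6 + (p + d)).choose (q - 4) ≤ 2 * (p + q).choose (q - 4) := by
    have hside : 2 * (q - 4) * (3 * d + q - 7 + 1) ≤ 16 * q * 2 ^ q := by
      have := Nat.mul_le_mul (show q - 4 ≤ q by omega) (show 3 * d + q - 7 + 1 ≤ 8 * 2 ^ q by omega)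
      nlinarith
    have := choose_le_two_mul_choose (q - 4) (3 * d + q - 7) (p + 4) (by have := h16.trans hp; omega)
    rwa [show p + 4 + (q - 4) + 1 + (3 * d + q - 7) = 2 * d + 2 * q - 6 + (p + d) by omega,
      show p + 4 + (q - 4) = p + q by omega] at this
  have hdown := four_down p q hq
  have h24 := choose_four_mul_le (2 * d + 2 * q - 2)
  have hkey : 384 * 2 ^ q * (2 * d + 2 * q - 2).choose 4 * (q * (q - 1) * (q - 2) * (q - 3)) ≤ 10 * μ * p ^ 4 := by
    have hq1 : q * (q - 1) * (q - 2) * (q - 3) ≤ q ^ 4 := by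
      calc q * (q - 1) * (q - 2) * (q - 3) ≤ q * q * q * q :=
            Nat.mul_le_mul (Nat.mul_le_mul (Nat.mul_le_mul le_rfl (Nat.sub_le q 1)) (Nat.sub_le q 2)) (Nat.sub_le q 3)
        _ = q ^ 4 := by ring
    -- `128·x·(d+q)^4·q^4 ≤ 5·μ·p^4` suffices (multiply by `24`; `(2d+2q−2)^4 ≤ (2(d+q))^4 = 16(d+q)^4`)
    suffices hs : 128 * 2 ^ q * (d + q) ^ 4 * q ^ 4 ≤ 5 * μ * p ^ 4 by
      have hpow : (2 * d + 2 * q - 2) ^ 4 ≤ 16 * (d + q) ^ 4 := by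
        calc (2 * d + 2 * q - 2) ^ 4 ≤ (2 * (d + q)) ^ 4 := Nat.pow_le_pow_left (by omega) 4
          _ = 16 * (d + q) ^ 4 := by ring
      have e : 24 * (384 * 2 ^ q * (2 * d + 2 * q - 2).choose 4 * (q * (q - 1) * (q - 2) * (q - 3))) ≤
          24 * (10 * μ * p ^ 4) := by
        calc 24 * (384 * 2 ^ q * (2 * d + 2 * q - 2).choose 4 * (q * (q - 1) * (q - 2) * (q - 3)))
            = 384 * 2 ^ q * (24 * (2 * d + 2 * q - 2).choose 4) * (q * (q - 1) * (q - 2) * (q - 3)) := by ring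
          _ ≤ 384 * 2 ^ q * (16 * (d + q) ^ 4) * q ^ 4 :=
              Nat.mul_le_mul (Nat.mul_le_mul_left _ (h24.trans hpow)) hq1
          _ = 48 * (128 * 2 ^ q * (d + q) ^ 4 * q ^ 4) := by ring
          _ ≤ 48 * (5 * μ * p ^ 4) := Nat.mul_le_mul_left _ hs
          _ = 24 * (10 * μ * p ^ 4) := by ring
      omega
    rcases le_total d (2 ^ (q - 1) - q) with hc | hc
    · -- regime (i): `μ = d`, `d + q ≤ 2^{q−1}`, `d + q ≤ 2d`: `(d+q)^4 ≤ (2^{q−1})^3·2d`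
      rw [hμ, min_eq_right hc]
      have hdq : d + q ≤ 2 ^ (q - 1) := by omega
      have h3 : (d + q) ^ 3 ≤ (2 ^ (q - 1)) ^ 3 := Nat.pow_le_pow_left hdq 3
      calc 128 * 2 ^ q * (d + q) ^ 4 * q ^ 4 = 128 * 2 ^ q * ((d + q) ^ 3 * (d + q)) * q ^ 4 := by ring
        _ ≤ 128 * 2 ^ q * ((2 ^ (q - 1)) ^ 3 * (2 * d)) * q ^ 4 :=
            Nat.mul_le_mul_right _ (Nat.mul_le_mul_left _ (Nat.mul_le_mul h3 (by omega)))
        _ = 32 * (2 ^ q * (2 * 2 ^ (q - 1)) ^ 3) * d * q ^ 4 := by ring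
        _ = 32 * (d * q ^ 4 * (2 ^ q) ^ 4) := by rw [hy]; ring
        _ ≤ 800000 * (d * q ^ 4 * (2 ^ q) ^ 4) := Nat.mul_le_mul_right _ (by norm_num)
        _ = 5 * d * (160000 * q ^ 4 * (2 ^ q) ^ 4) := by ring
        _ ≤ 5 * d * p ^ 4 := Nat.mul_le_mul_left _ hp4
    · -- regime (ii): `μ ≥ 2^{q−2}`, `d + q ≤ 2^{q+1}`
      rw [hμ, min_eq_left hc]
      have hμz : 2 ^ (q - 2) ≤ 2 ^ (q - 1) - q := by omega
      have hdq : d + q ≤ 2 * 2 ^ q := by omega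
      have h4 : (d + q) ^ 4 ≤ (2 * 2 ^ q) ^ 4 := Nat.pow_le_pow_left hdq 4
      calc 128 * 2 ^ q * (d + q) ^ 4 * q ^ 4 ≤ 128 * 2 ^ q * (2 * 2 ^ q) ^ 4 * q ^ 4 :=
            Nat.mul_le_mul_right _ (Nat.mul_le_mul_left _ h4)
        _ = 8192 * (2 ^ (q - 2) * q ^ 4 * (2 ^ q) ^ 4) := by rw [← hz]; ring
        _ ≤ 800000 * (2 ^ (q - 2) * q ^ 4 * (2 ^ q) ^ 4) := Nat.mul_le_mul_right _ (by norm_num)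
        _ = 5 * 2 ^ (q - 2) * (160000 * q ^ 4 * (2 ^ q) ^ 4) := by ring
        _ ≤ 5 * 2 ^ (q - 2) * p ^ 4 := Nat.mul_le_mul_left _ hp4
        _ ≤ 5 * (2 ^ (q - 1) - q) * p ^ 4 := Nat.mul_le_mul_right _ (Nat.mul_le_mul_left _ hμz)
  have hpos : 0 < p ^ 4 := by positivity
  apply Nat.le_of_mul_le_mul_right _ hpos
  calc 192 * 2 ^ q * ((2 * d + 2 * q - 2).choose 4 * (2 * d + 2 * q - 6 + (p + d)).choose (q - 4)) * p ^ 4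
      ≤ 192 * 2 ^ q * ((2 * d + 2 * q - 2).choose 4 * (2 * (p + q).choose (q - 4))) * p ^ 4 :=
        Nat.mul_le_mul_right _ (Nat.mul_le_mul_left _ (Nat.mul_le_mul_left _ h2))
    _ = 384 * 2 ^ q * (2 * d + 2 * q - 2).choose 4 * (p ^ 4 * (p + q).choose (q - 4)) := by ring
    _ ≤ 384 * 2 ^ q * (2 * d + 2 * q - 2).choose 4 * (q * (q - 1) * (q - 2) * (q - 3) * (p + q).choose q) :=
        Nat.mul_le_mul_left _ hdown
    _ = (384 * 2 ^ q * (2 * d + 2 * q - 2).choose 4 * (q * (q - 1) * (q - 2) * (q - 3))) * (p + q).choose q := by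
        ring
    _ ≤ (10 * μ * p ^ 4) * (p + q).choose q := Nat.mul_le_mul_right _ hkey
    _ = 10 * μ * (p + q).choose q * p ^ 4 := by ring

end Explicit

end ThmN

end PercRepro
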